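import Literature.Analysis.Distribution.EllipticPointSolvability
import Literature.Analysis.Distribution.DivFormRegularity
import HarnessLib

/-!
# Local solvability, with small `L²` norm, of divergence-form elliptic equations with smooth
# coefficients and smooth right-hand side

Analysis/Distribution support file (everything proved; no definitions, no named facts) on the
discharge path of `Literature.Geometry.Lorentzian.mullerZumHagen1970_analytic_of_timelikeKilling`
(Müller zum Hagen 1970: analyticity of stationary vacuum metrics), whose second step is the
construction of HARMONIC coordinates adapted to the stationary Killing field, i.e. of local
solutions, with controlled 1-jet, of the divergence-form elliptic equations `∂ᵢ(Aⁱʲ ∂ⱼ h) = F` on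
the 3-dimensional quotient (Müller zum Hagen 1970, p. 200, citing Bers–John–Schechter, *Partial
Differential Equations* (1964), Part II, Ch. 5; the same input as DeTurck–Kazdan, Ann. Sci. ÉNS 14
(1981), Lemma 1.2). This file proves the existence half in the following quantitative form.

Let `E` be a finite-dimensional real normed space of dimension `1 ≤ n ≤ 3` with an additive Haar
measure `μ`, `b` a basis, `aᵢⱼ, c ∈ C^∞(E)` with `(aᵢⱼ(x))` positive definite at every point, and
`L w = ∑ᵢⱼ ∂ⱼ(aᵢⱼ ∂ᵢ w) − c w` (`∂ₖ = D(·)(bₖ)`).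

* `smoothDiffOp_divForm` — the operator presented by `divFormWords`/`divFormCoeff`
  (`DivFormRegularity.lean`) is `P φ = ∑ᵢⱼ ∂ᵢ(aᵢⱼ ∂ⱼφ) − c φ` (so that `ᵗP = L`,
  `smoothDiffOpTranspose_divForm`, and `P` is the transpose-presentation of `L`);
* `exists_apriori_smoothDiffOp_forall` — the a priori inequality of
  `EllipticPointSolvability.lean` at ALL points: for a smooth presentation elliptic of order `k`
  near `x₀` with `2k > n` there are an open `U ∋ x₀` and `C` with `|φ(y)| ≤ C ‖P φ‖_{L²(μ)}` for
  every `y` and every smooth `φ` supported in `U` (same proof, through the model space and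
  `exists_pointwise_le_smoothDiffOp`);
* `exists_smooth_solution_divForm` — **local solvability**: for every `x₀` there are `ε₀ > 0` and
  `C ≥ 0` such that for every `0 < ε ≤ ε₀` and every `G ∈ C^∞(E)` there is `w ∈ C^∞(B(x₀, ε))`
  with `L w = G` on `B(x₀, ε)` and `∫_{B(x₀,ε)} w² dμ ≤ C · μ(B(x₀, ε))² · M²` whenever `|G| ≤ M`
  on `B̄(x₀, ε)`. Proof (Hörmander's duality method, as in `exists_pointMass_solution`): by the a
  priori inequality `‖φ‖_{L²} ≤ μ(B_ε)^{1/2} C₀ ‖Pφ‖_{L²}` on `𝓓(B_ε)`, so the functional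
  `P φ ↦ ∫ G φ dμ` is bounded by `C₀ μ(B_ε) M ‖Pφ‖`; Hahn–Banach and Riesz give `u ∈ L²(μ)` with
  `∫ u Pφ = ∫ G φ` and `‖u‖ ≤ C₀ μ(B_ε) M`; since `P = ᵗQ` for the presentation `Q` of the
  transposed coefficients, Folland's Cor. (6.34) (`Folland1995_cor634_holds`) makes `u` smooth on
  `B_ε`, and integrating by parts (`integral_smoothDiffOp_mul`) the smooth representative solves
  `L w = G` classically.

The smallness `∫ w² = O(ε^{2n})` is what makes the centre gradient of `w` small for small `ε`
(sequel: interior estimates), hence `xₘ − wₘ` admissible harmonic coordinates.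

## References

* G. B. Folland, *Introduction to Partial Differential Equations*, 2nd ed. (1995), Thm. (8.45)
  (local solvability by duality) and Cor. (6.34). [Folland2020]
* L. Hörmander, *The Analysis of Linear Partial Differential Operators I–II* (1990), §7.9,
  Thm. 13.3.3 (folklore).
* L. Bers, F. John, M. Schechter, *Partial Differential Equations*, Interscience 1964, Part II,
  Ch. 5 (local existence for elliptic equations; cited by Müller zum Hagen 1970).
* H. Müller zum Hagen, Proc. Camb. Phil. Soc. 68 (1970) 199–201. [MullerZumHagen1970]
-/

noncomputable section

open MeasureTheory Set Filter Function TopologicalSpace Real Metric Distributions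
open scoped Topology InnerProductSpace ContDiff ENNReal NNReal

namespace Literature.Analysis.Distribution

open Literature.Analysis.Hypoelliptic

/-! ### The divergence-form presentation acting on smooth functions -/

section Presentation

variable {E : Type*} [NormedAddCommGroup E] [NormedSpace ℝ E]
  {κ : Type*} [Fintype κ] [DecidableEq κ] (b : Module.Basis κ ℝ E)

omit [DecidableEq κ] in
/-- All coefficients of the divergence-form presentation are smooth (words of length `≥ 3` have
coefficient `0`). [folklore] -/
theorem contDiff_divFormCoeff_all {a : κ → κ → E → ℝ} {c : E → ℝ}
    (ha : ∀ i j, ContDiff ℝ ∞ (a i j)) (hc : ContDiff ℝ ∞ c) :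
    ∀ w, ContDiff ℝ ∞ (divFormCoeff b a c w)
  | [] => by rw [divFormCoeff_nil]; exact hc.neg
  | [j] => by
    rw [divFormCoeff_single]
    exact ContDiff.sum fun i _ ↦
      ((ha i j).fderiv_right (m := ∞) (by exact_mod_cast le_top)).clm_apply contDiff_const
  | [i, j] => by rw [divFormCoeff_pair]; exact ha i j
  | _ :: _ :: _ :: _ => contDiff_const

/-- **The presented operator on smooth functions**: `P φ = ∑ᵢⱼ ∂ᵢ(aᵢⱼ ∂ⱼ φ) − c φ` for the
presentation `P = ∑ᵢⱼ aᵢⱼ ∂ᵢ∂ⱼ + ∑ⱼ (∑ᵢ ∂ᵢaᵢⱼ) ∂ⱼ − c` by words in the constant fields `bₖ`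
(Leibniz rule). Together with `smoothDiffOpTranspose_divForm` (`ᵗP φ = ∑ᵢⱼ ∂ⱼ(aᵢⱼ ∂ᵢφ) − cφ`):
`P` is the formal transpose of the divergence-form operator, and coincides with it for symmetric
`a`. [folklore] -/
theorem smoothDiffOp_divForm {a : κ → κ → E → ℝ} {c : E → ℝ} (ha : ∀ i j, ContDiff ℝ ∞ (a i j))
    {φ : E → ℝ} (hφ : ContDiff ℝ ∞ φ) (x : E) :
    smoothDiffOp (fun k : κ ↦ fun _ : E ↦ b k) (divFormWords κ) (divFormCoeff b a c) φ x =
      (∑ i, ∑ j, fderiv ℝ (fun y ↦ a i j y * fderiv ℝ φ y (b j)) x (b i)) - c x * φ x := by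
  have h1 : ContDiff ℝ 1 φ := hφ.of_le (by exact_mod_cast le_top)
  have hdφ : ∀ j, ContDiff ℝ ∞ (fun y ↦ fderiv ℝ φ y (b j)) := fun j ↦
    (hφ.fderiv_right (m := ∞) (by exact_mod_cast le_top)).clm_apply contDiff_const
  have hfd : ∀ j, fieldDeriv (fun _ : E ↦ b j) φ = fun y ↦ fderiv ℝ φ y (b j) := fun j ↦ rfl
  unfold smoothDiffOp
  rw [sum_divFormWords]
  simp only [wordDeriv_cons, wordDeriv_nil, hfd, fieldDeriv, divFormCoeff_pair, divFormCoeff_single,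
    divFormCoeff_nil]
  have h0 : -c x * φ x = -(c x * φ x) := by ring
  rw [h0, ← sub_eq_add_neg]
  congr 1
  have hprod : ∀ i j, fderiv ℝ (fun y ↦ a i j y * fderiv ℝ φ y (b j)) x (b i) =
      fderiv ℝ (a i j) x (b i) * fderiv ℝ φ x (b j) +
        a i j x * fderiv ℝ (fun y ↦ fderiv ℝ φ y (b j)) x (b i) := by
    intro i j
    rw [fderiv_fun_mul ((ha i j).differentiable (by simp) x) ((hdφ j).differentiable (by simp) x)]
    simp only [add_apply, smul_apply, smul_eq_mul]
    ring
  simp only [hprod, Finset.sum_add_distrib]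
  have hfirst : ∑ j, (∑ i, fderiv ℝ (a i j) x (b i)) * fderiv ℝ φ x (b j) =
      ∑ i, ∑ j, fderiv ℝ (a i j) x (b i) * fderiv ℝ φ x (b j) := by
    rw [Finset.sum_comm]
    exact Finset.sum_congr rfl fun j _ ↦ Finset.sum_mul _ _ _
  rw [hfirst]
  ring

end Presentation

section Transpose

variable {E : Type*} {κ : Type*} [Fintype κ]

/-- Positive definiteness of `(aᵢⱼ)` passes to the transposed coefficients `(aⱼᵢ)`. [folklore] -/
theorem divForm_pos_transpose {a : κ → κ → E → ℝ} {s : Set E}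
    (hpos : ∀ x ∈ s, ∀ v : κ → ℝ, v ≠ 0 → 0 < ∑ i, ∑ j, a i j x * (v i * v j)) :
    ∀ x ∈ s, ∀ v : κ → ℝ, v ≠ 0 → 0 < ∑ i, ∑ j, a j i x * (v i * v j) := by
  intro x hx v hv
  have h := hpos x hx v hv
  rw [Finset.sum_comm]
  simpa only [mul_comm (v _) (v _)] using h

end Transpose

/-! ### The a priori estimate at all points -/

section APriori

variable {E : Type*} [NormedAddCommGroup E] [NormedSpace ℝ E] [FiniteDimensional ℝ E]
  [MeasurableSpace E] [BorelSpace E]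
  {ι : Type*} {X : ι → E → E} {S : Finset (List ι)} {a : List ι → E → ℝ} {k : ℕ}

/-- **`|φ(y)| ≤ C ‖P φ‖_{L²(μ)}` near `x₀`, at every point `y`.** For a smooth presentation
elliptic of order `k` on the open set `Ω ∋ x₀` with `2k > dim E` and an additive Haar measure
`μ`, there are an open `U ∋ x₀`, `U ⊆ Ω`, and `C ≥ 0` with `|φ y| ≤ C ‖P φ‖_{L²(μ)}` for every
`y` and every smooth `φ` with `tsupport φ ⊆ U` (the proof of `exists_apriori_smoothDiffOp`, whose
model-space input `exists_pointwise_le_smoothDiffOp` is uniform in the point). Folland 1995,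
Thm. (8.45) (folklore form). [folklore] -/
theorem exists_apriori_smoothDiffOp_forall [Nontrivial E] (μ : Measure E) [μ.IsAddHaarMeasure]
    (hX : ∀ i, ContDiff ℝ ∞ (X i)) (ha : ∀ w, ContDiff ℝ ∞ (a w))
    {Ω : Set E} (hΩ : IsOpen Ω) (hell : IsEllipticOn X S a k Ω)
    (hk : (Module.finrank ℝ E : ℝ) < 2 * k) {x₀ : E} (hx₀ : x₀ ∈ Ω) :
    ∃ U : Set E, IsOpen U ∧ x₀ ∈ U ∧ U ⊆ Ω ∧ ∃ C : ℝ, 0 ≤ C ∧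
      ∀ φ : E → ℝ, ContDiff ℝ ∞ φ → tsupport φ ⊆ U → ∀ y : E,
        |φ y| ≤ C * (eLpNorm (smoothDiffOp X S a φ) 2 μ).toReal := by
  -- the model space
  set T : E ≃L[ℝ] EuclideanSpace ℝ (Fin (Module.finrank ℝ E)) := toEuclidean with hTdef
  haveI : Nontrivial (EuclideanSpace ℝ (Fin (Module.finrank ℝ E))) := T.injective.nontrivial
  set Y : ι → EuclideanSpace ℝ (Fin (Module.finrank ℝ E)) → EuclideanSpace ℝ (Fin (Module.finrank ℝ E)) :=
    fun i => push T (X i) with hY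
  set b : List ι → EuclideanSpace ℝ (Fin (Module.finrank ℝ E)) → ℝ := pushCoef T a with hb
  have hYs : ∀ i, ContDiff ℝ ∞ (Y i) := fun i => contDiff_push T (hX i)
  have hbs : ∀ w, ContDiff ℝ ∞ (b w) := fun w => (ha w).comp T.symm.contDiff
  have hkV : (Module.finrank ℝ (EuclideanSpace ℝ (Fin (Module.finrank ℝ E))) : ℝ) < 2 * k := by
    rw [← T.toLinearEquiv.finrank_eq]; exact hk
  -- a ball around `T x₀` inside `T(Ω)`
  have hΩ' : IsOpen ((T.symm : _ → E) ⁻¹' Ω) := hΩ.preimage T.symm.continuous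
  obtain ⟨r, hr, hrΩ⟩ := Metric.isOpen_iff.1 hΩ' (T x₀) (by simpa using hx₀)
  set R₀ : ℝ := r / 4 with hR₀
  have hR₀0 : 0 < R₀ := by positivity
  -- the cutoffs `χ ≤ χ₁`
  obtain ⟨χ, hχs, hχc, hχsupp, hχ1⟩ := exists_bump (isCompact_closedBall (T x₀) R₀) isOpen_ball
    (closedBall_subset_ball (by linarith : R₀ < 2 * R₀))
  obtain ⟨χ₁, hχ₁s, hχ₁c, hχ₁supp, hχ₁1⟩ := exists_bump (isCompact_closedBall (T x₀) (2 * R₀))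
    isOpen_ball (closedBall_subset_ball (by linarith : 2 * R₀ < 3 * R₀))
  have hχχ₁ : ∀ y ∈ tsupport χ, χ₁ y = 1 := fun y hy =>
    hχ₁1 y (ball_subset_closedBall (hχsupp hy))
  have hell' : ∀ y ∈ tsupport χ₁, ∀ ξ, ξ ≠ 0 → twSymb Y S b k y ξ ≠ 0 := by
    intro y hy ξ hξ
    have hyΩ : T.symm y ∈ Ω := hrΩ (ball_subset_ball (by linarith) (hχ₁supp hy))
    have h := twSymb_ne_zero_of_isEllipticOn hell T hyΩ hξ
    simpa [hY, hb] using h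
  have hχR : ∀ y ∈ ball (T x₀) R₀, χ y = 1 := fun y hy => hχ1 y (ball_subset_closedBall hy)
  obtain ⟨ε, hε, hεR, C, hC, hest⟩ := exists_pointwise_le_smoothDiffOp hYs hbs hell.1 hkV hχs hχc
    hχ₁s hχ₁c hχχ₁ hell' hR₀0 hχR
  -- comparison of the measures `μ.map T = c • volume`
  set ν : Measure (EuclideanSpace ℝ (Fin (Module.finrank ℝ E))) := μ.map T with hν
  haveI : ν.IsAddHaarMeasure := T.isAddHaarMeasure_map μ
  set c : ℝ≥0 := Measure.addHaarScalarFactor ν volume with hc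
  have hνeq : ν = c • (volume : Measure (EuclideanSpace ℝ (Fin (Module.finrank ℝ E)))) :=
    Measure.isAddLeftInvariant_eq_smul ν volume
  have hcpos : 0 < c := Measure.addHaarScalarFactor_pos_of_isAddHaarMeasure ν volume
  have hcomp : ∀ f : EuclideanSpace ℝ (Fin (Module.finrank ℝ E)) → ℝ, Continuous f →
      (eLpNorm f 2 volume).toReal =
        ((c : ℝ) ^ (2 : ℝ)⁻¹)⁻¹ * (eLpNorm (fun x => f (T x)) 2 μ).toReal := by
    intro f hf
    have e1 : eLpNorm f 2 ν = eLpNorm (fun x => f (T x)) 2 μ :=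
      eLpNorm_map_measure hf.aestronglyMeasurable T.continuous.measurable.aemeasurable
    have e2 : eLpNorm f 2 ν = c ^ (2 : ℝ≥0∞).toReal⁻¹ • eLpNorm f 2 volume := by
      rw [hνeq]; exact eLpNorm_smul_measure_of_ne_top' (by simp) c f
    have e3 : (eLpNorm (fun x => f (T x)) 2 μ).toReal = (c : ℝ) ^ (2 : ℝ)⁻¹ * (eLpNorm f 2 volume).toReal := by
      rw [← e1, e2, ENNReal.toReal_smul, NNReal.smul_def, NNReal.coe_rpow, smul_eq_mul]
      norm_num
    have hcr : 0 < (c : ℝ) ^ (2 : ℝ)⁻¹ := Real.rpow_pos_of_pos (NNReal.coe_pos.2 hcpos) _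
    rw [e3, ← mul_assoc, inv_mul_cancel₀ hcr.ne', one_mul]
  -- the neighbourhood `U = T⁻¹ B(T x₀, ε)`
  set U : Set E := (T : E → _) ⁻¹' ball (T x₀) ε with hU
  have hUo : IsOpen U := isOpen_ball.preimage T.continuous
  have hx₀U : x₀ ∈ U := by simp [hU, hε]
  have hUΩ : U ⊆ Ω := fun z hz => by
    have h : T.symm (T z) ∈ Ω := hrΩ (ball_subset_ball (by linarith) hz)
    simpa using h
  refine ⟨U, hUo, hx₀U, hUΩ, C * ((c : ℝ) ^ (2 : ℝ)⁻¹)⁻¹, by positivity, fun φ hφ hφU y => ?_⟩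
  -- transport `φ` to `ψ = φ ∘ T⁻¹`
  set ψ : EuclideanSpace ℝ (Fin (Module.finrank ℝ E)) → ℝ := fun y => φ (T.symm y) with hψ
  have hψs : ContDiff ℝ ∞ ψ := hφ.comp T.symm.contDiff
  have hψsupp : tsupport ψ ⊆ ball (T x₀) ε := by
    refine (tsupport_comp_symm_subset T φ).trans fun y hy => ?_
    have h := hφU hy
    simpa [hU] using h
  have hψφ : (fun x => ψ (T x)) = φ := by ext x; simp [hψ]
  have hPcomp : (fun x => smoothDiffOp Y S b ψ (T x)) = smoothDiffOp X S a φ := by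
    ext x; rw [← smoothDiffOp_comp T hX S a hψs x, hψφ]
  have hPψc : Continuous (smoothDiffOp Y S b ψ) :=
    (contDiff_smoothDiffOp hYs (fun w _ => hbs w) hψs).continuous
  have h := hest ψ hψs hψsupp (T y)
  rw [show ψ (T y) = φ y by simp [hψ], hcomp _ hPψc, hPcomp] at h
  calc |φ y| ≤ C * (((c : ℝ) ^ (2 : ℝ)⁻¹)⁻¹ * (eLpNorm (smoothDiffOp X S a φ) 2 μ).toReal) := h
    _ = _ := by ring

end APriori

/-! ### Local solvability with small `L²` norm -/

section Solvability

variable {E : Type} [NormedAddCommGroup E] [NormedSpace ℝ E] [FiniteDimensional ℝ E]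
  [MeasurableSpace E] [BorelSpace E] (μ : Measure E) [μ.IsAddHaarMeasure]
  {κ : Type} [Fintype κ] [DecidableEq κ] (b : Module.Basis κ ℝ E)

omit [FiniteDimensional ℝ E] [MeasurableSpace E] [BorelSpace E] [DecidableEq κ] in
/-- **Locality of the divergence-form operator**: `L f (y)` only depends on the germ of `f` at
`y`. [folklore] -/
theorem divFormOp_congr_of_eventuallyEq (a : κ → κ → E → ℝ) (c : E → ℝ) {f g : E → ℝ} {y : E}
    (h : f =ᶠ[𝓝 y] g) :
    (∑ i, ∑ j, fderiv ℝ (fun z ↦ a i j z * fderiv ℝ f z (b i)) y (b j)) - c y * f y =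
      (∑ i, ∑ j, fderiv ℝ (fun z ↦ a i j z * fderiv ℝ g z (b i)) y (b j)) - c y * g y := by
  have hd : fderiv ℝ f =ᶠ[𝓝 y] fderiv ℝ g := h.fderiv
  have hij : ∀ i j, (fun z ↦ a i j z * fderiv ℝ f z (b i)) =ᶠ[𝓝 y]
      fun z ↦ a i j z * fderiv ℝ g z (b i) := by
    intro i j
    filter_upwards [hd] with z hz
    rw [hz]
  have hterm : ∀ i j, fderiv ℝ (fun z ↦ a i j z * fderiv ℝ f z (b i)) y =
      fderiv ℝ (fun z ↦ a i j z * fderiv ℝ g z (b i)) y := fun i j ↦ (hij i j).fderiv_eq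
  simp only [hterm, h.self_of_nhds]

omit [FiniteDimensional ℝ E] [MeasurableSpace E] [BorelSpace E] [DecidableEq κ] in
/-- The divergence-form operator of a function smooth on an open set is continuous there.
[folklore] -/
theorem continuousOn_divFormOp {a : κ → κ → E → ℝ} (ha : ∀ i j, ContDiff ℝ ∞ (a i j))
    {c : E → ℝ} (hc : ContDiff ℝ ∞ c) {f : E → ℝ} {U : Set E} (hU : IsOpen U)
    (hf : ContDiffOn ℝ ∞ f U) :
    ContinuousOn (fun y ↦ (∑ i, ∑ j, fderiv ℝ (fun z ↦ a i j z * fderiv ℝ f z (b i)) y (b j)) -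
      c y * f y) U := by
  have hdf : ContDiffOn ℝ ∞ (fderiv ℝ f) U := hf.fderiv_of_isOpen hU (by simp)
  have hdfi : ∀ i, ContDiffOn ℝ ∞ (fun z ↦ fderiv ℝ f z (b i)) U := fun i ↦
    hdf.clm_apply contDiffOn_const
  have hprod : ∀ i j, ContDiffOn ℝ ∞ (fun z ↦ a i j z * fderiv ℝ f z (b i)) U := fun i j ↦
    (ha i j).contDiffOn.mul (hdfi i)
  have hsec : ∀ i j, ContDiffOn ℝ ∞ (fun y ↦ fderiv ℝ (fun z ↦ a i j z * fderiv ℝ f z (b i)) y (b j))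
      U := fun i j ↦ ((hprod i j).fderiv_of_isOpen hU (by simp)).clm_apply contDiffOn_const
  refine ContinuousOn.sub ?_ (hc.continuous.continuousOn.mul hf.continuousOn)
  exact continuousOn_finsetSum _ fun i _ ↦ continuousOn_finsetSum _ fun j _ ↦
    (hsec i j).continuousOn

/-- **Local solvability of divergence-form elliptic equations with smooth coefficients, with small
`L²` norm** (the existence input of harmonic / stationary-harmonic coordinates: Müller zum Hagen
1970, p. 200, via Bers–John–Schechter 1964, Part II, Ch. 5; Folland 1995, Thm. (8.45) for smooth
right-hand sides, by Hörmander's duality method). Let `dim E ≤ 3`, `μ` an additive Haar measure,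
`b` a basis, `aᵢⱼ, c ∈ C^∞(E)` with `∑ᵢⱼ aᵢⱼ(x) vᵢ vⱼ > 0` for `v ≠ 0` at every `x`. Then for every
`x₀` there are `ε₀ > 0` and `C ≥ 0` such that for all `0 < ε ≤ ε₀` and all `G ∈ C^∞(E)` there is
`w`, `C^∞` on `B(x₀, ε)`, with
`∑ᵢⱼ ∂ⱼ(aᵢⱼ ∂ᵢ w) − c w = G` on `B(x₀, ε)` and `∫_{B(x₀,ε)} w² dμ ≤ C μ(B(x₀,ε))² M²` whenever
`|G| ≤ M` on `B̄(x₀, ε)`. See the module docstring for the proof.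
[cite: Folland2020, Thm. (8.45) and Cor. (6.34)] -/
theorem exists_smooth_solution_divForm [Nontrivial E]
    {a : κ → κ → E → ℝ} (ha : ∀ i j, ContDiff ℝ ∞ (a i j)) {c : E → ℝ} (hc : ContDiff ℝ ∞ c)
    (hpos : ∀ x, ∀ v : κ → ℝ, v ≠ 0 → 0 < ∑ i, ∑ j, a i j x * (v i * v j))
    (hdim : (Module.finrank ℝ E : ℝ) < 4) (x₀ : E) :
    ∃ ε₀ : ℝ, 0 < ε₀ ∧ ∃ C : ℝ, 0 ≤ C ∧ ∀ ε : ℝ, 0 < ε → ε ≤ ε₀ →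
      ∀ G : E → ℝ, ContDiff ℝ ∞ G →
        ∃ w : E → ℝ, ContDiffOn ℝ ∞ w (ball x₀ ε) ∧
          (∀ x ∈ ball x₀ ε,
            (∑ i, ∑ j, fderiv ℝ (fun y ↦ a i j y * fderiv ℝ w y (b i)) x (b j)) - c x * w x = G x) ∧
          ∀ M : ℝ, (∀ x ∈ closedBall x₀ ε, |G x| ≤ M) →
            ∫ x in ball x₀ ε, w x ^ 2 ∂μ ≤ C * (μ (ball x₀ ε)).toReal ^ 2 * M ^ 2 := by
  classical
  -- the presentations `P` (coefficients `a`) and `Q` (transposed coefficients)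
  set Xc : κ → E → E := fun k _ ↦ b k with hXc
  have hXs : ∀ k, ContDiff ℝ ∞ (Xc k) := fun _ ↦ contDiff_const
  set S : Finset (List κ) := divFormWords κ with hS
  set A : List κ → E → ℝ := divFormCoeff b a c with hA
  set a' : κ → κ → E → ℝ := fun i j ↦ a j i with ha'
  have ha's : ∀ i j, ContDiff ℝ ∞ (a' i j) := fun i j ↦ ha j i
  set A' : List κ → E → ℝ := divFormCoeff b a' c with hA'
  have hAs : ∀ w, ContDiff ℝ ∞ (A w) := contDiff_divFormCoeff_all b ha hc
  have hAS : ∀ w ∈ S, ContDiff ℝ ∞ (A w) := fun w _ ↦ hAs w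
  have hA'S : ∀ w ∈ S, ContDiff ℝ ∞ (A' w) := fun w _ ↦ contDiff_divFormCoeff_all b ha's hc w
  have hellP : IsEllipticOn Xc S A 2 univ := isEllipticOn_divForm b c fun x _ ↦ hpos x
  -- the three operator identities
  have hPL : ∀ {φ : E → ℝ}, ContDiff ℝ ∞ φ → ∀ x, smoothDiffOp Xc S A φ x =
      (∑ i, ∑ j, fderiv ℝ (fun y ↦ a i j y * fderiv ℝ φ y (b j)) x (b i)) - c x * φ x :=
    fun hφ x ↦ smoothDiffOp_divForm b ha hφ x
  have hQt : ∀ {φ : E → ℝ}, ContDiff ℝ ∞ φ → ∀ x,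
      smoothDiffOpTranspose Xc S A' φ x = smoothDiffOp Xc S A φ x := by
    intro φ hφ x
    rw [hPL hφ x, hA', smoothDiffOpTranspose_divForm b ha's hφ x, Finset.sum_comm]
  have hPt : ∀ {φ : E → ℝ}, ContDiff ℝ ∞ φ → ∀ x, smoothDiffOpTranspose Xc S A φ x =
      (∑ i, ∑ j, fderiv ℝ (fun y ↦ a i j y * fderiv ℝ φ y (b i)) x (b j)) - c x * φ x :=
    fun hφ x ↦ smoothDiffOpTranspose_divForm b ha hφ x
  -- the a priori estimate
  have hk : (Module.finrank ℝ E : ℝ) < 2 * (2 : ℕ) := by push_cast; linarith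
  obtain ⟨U, hUo, hx₀U, -, C₀, hC₀, hest⟩ :=
    exists_apriori_smoothDiffOp_forall μ hXs hAs isOpen_univ hellP hk (mem_univ x₀)
  obtain ⟨ε₀, hε₀, hballU⟩ := Metric.isOpen_iff.1 hUo x₀ hx₀U
  refine ⟨ε₀, hε₀, C₀ ^ 2, by positivity, fun ε hε hεε₀ G hG ↦ ?_⟩
  -- the ball
  set B : Set E := ball x₀ ε with hB
  have hBo : IsOpen B := isOpen_ball
  let Bo : Opens E := ⟨B, hBo⟩
  have hBU : B ⊆ U := (ball_subset_ball hεε₀).trans hballU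
  have hμB : μ B < ⊤ := measure_ball_lt_top
  have hBm : MeasurableSet B := measurableSet_ball
  set V : ℝ := (μ B).toReal with hV
  have hV0 : 0 ≤ V := ENNReal.toReal_nonneg
  -- a bound for `G` on the closed ball
  obtain ⟨M₀, hM₀⟩ := (isCompact_closedBall x₀ ε).exists_bound_of_continuousOn
    hG.continuous.continuousOn
  have hM₀' : ∀ x ∈ closedBall x₀ ε, |G x| ≤ M₀ := fun x hx ↦ by
    rw [← Real.norm_eq_abs]; exact hM₀ x hx
  have hM₀0 : 0 ≤ M₀ := (abs_nonneg _).trans (hM₀' x₀ (mem_closedBall_self hε.le))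
  -- `P φ ∈ L²(μ)` for test functions on the ball
  have hPs : ∀ φ : 𝓓(Bo, ℝ), ContDiff ℝ ∞ (smoothDiffOp Xc S A φ) := fun φ ↦
    contDiff_smoothDiffOp hXs hAS φ.contDiff
  have hPsupp : ∀ φ : 𝓓(Bo, ℝ), tsupport (smoothDiffOp Xc S A φ) ⊆ B := fun φ ↦
    (tsupport_smoothDiffOp_subset S A _).trans φ.tsupport_subset
  have hPc : ∀ φ : 𝓓(Bo, ℝ), HasCompactSupport (smoothDiffOp Xc S A φ) := fun φ ↦
    φ.hasCompactSupport.mono' ((subset_tsupport _).trans (tsupport_smoothDiffOp_subset S A _))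
  have hmem : ∀ φ : 𝓓(Bo, ℝ), MemLp (smoothDiffOp Xc S A φ) 2 μ := fun φ ↦
    (hPs φ).continuous.memLp_of_hasCompactSupport (hPc φ)
  -- the linear map `φ ↦ [P φ] ∈ L²(μ)`
  let Tm : 𝓓(Bo, ℝ) →ₗ[ℝ] Lp ℝ 2 μ :=
    { toFun := fun φ ↦ (hmem φ).toLp _
      map_add' := fun φ ψ ↦ by
        refine Lp.ext_iff.2 ?_
        filter_upwards [(hmem (φ + ψ)).coeFn_toLp, (hmem φ).coeFn_toLp, (hmem ψ).coeFn_toLp,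
          Lp.coeFn_add ((hmem φ).toLp _) ((hmem ψ).toLp _)] with x h1 h2 h3 h4
        rw [h4, Pi.add_apply, h1, h2, h3]
        have e : ((φ + ψ : 𝓓(Bo, ℝ)) : E → ℝ) = (φ : E → ℝ) + (ψ : E → ℝ) := rfl
        rw [e, smoothDiffOp_add hXs S A φ.contDiff ψ.contDiff, Pi.add_apply]
      map_smul' := fun r φ ↦ by
        refine Lp.ext_iff.2 ?_
        filter_upwards [(hmem (r • φ)).coeFn_toLp, (hmem φ).coeFn_toLp,
          Lp.coeFn_smul r ((hmem φ).toLp _)] with x h1 h2 h4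
        rw [RingHom.id_apply, h4, Pi.smul_apply, h1, h2, smul_eq_mul]
        have e : ((r • φ : 𝓓(Bo, ℝ)) : E → ℝ) = fun y ↦ r * φ y := rfl
        rw [e, smoothDiffOp_const_mul S A r] }
  have hTm : ∀ φ : 𝓓(Bo, ℝ), Tm φ = (hmem φ).toLp _ := fun φ ↦ rfl
  have hTm_norm : ∀ φ : 𝓓(Bo, ℝ), ‖Tm φ‖ = (eLpNorm (smoothDiffOp Xc S A φ) 2 μ).toReal :=
    fun φ ↦ by rw [hTm, Lp.norm_toLp]
  -- the a priori bound on the ball and the bound of the functional `φ ↦ ∫ G φ`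
  have hsup : ∀ φ : 𝓓(Bo, ℝ), ∀ y, |φ y| ≤ C₀ * ‖Tm φ‖ := fun φ y ↦ by
    rw [hTm_norm]; exact hest φ φ.contDiff (φ.tsupport_subset.trans hBU) y
  have hGφi : ∀ φ : 𝓓(Bo, ℝ), Integrable (fun x ↦ G x * φ x) μ := fun φ ↦
    (hG.continuous.mul φ.continuous).integrable_of_hasCompactSupport φ.hasCompactSupport.mul_left
  have hbound : ∀ M : ℝ, (∀ x ∈ closedBall x₀ ε, |G x| ≤ M) → ∀ φ : 𝓓(Bo, ℝ),
      |∫ x, G x * φ x ∂μ| ≤ C₀ * V * M * ‖Tm φ‖ := by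
    intro M hM φ
    have hMnn : 0 ≤ M := (abs_nonneg _).trans (hM x₀ (mem_closedBall_self hε.le))
    have hpt : ∀ x, ‖G x * φ x‖ ≤ B.indicator (fun _ ↦ M * (C₀ * ‖Tm φ‖)) x := by
      intro x
      by_cases hx : x ∈ B
      · rw [indicator_of_mem hx, Real.norm_eq_abs, abs_mul]
        exact mul_le_mul (hM x (ball_subset_closedBall hx)) (hsup φ x) (abs_nonneg _) hMnn
      · have hx' : x ∉ tsupport (φ : E → ℝ) := fun h ↦ hx (φ.tsupport_subset h)
        rw [indicator_of_notMem hx, image_eq_zero_of_notMem_tsupport hx', mul_zero, norm_zero]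
    have hint' : IntegrableOn (fun _ : E ↦ M * (C₀ * ‖Tm φ‖)) B μ :=
      integrableOn_const (hs := hμB.ne) (hC := enorm_ne_top)
    have hint : Integrable (B.indicator fun _ ↦ M * (C₀ * ‖Tm φ‖)) μ :=
      hint'.integrable_indicator hBm
    have h := norm_integral_le_of_norm_le hint (Eventually.of_forall hpt)
    rw [integral_indicator_const _ hBm, Real.norm_eq_abs, smul_eq_mul, Measure.real, ← hV] at h
    calc |∫ x, G x * φ x ∂μ| ≤ V * (M * (C₀ * ‖Tm φ‖)) := h
      _ = C₀ * V * M * ‖Tm φ‖ := by ring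
  -- the functional on `𝓓(B)`, the kernel inclusion, Hahn–Banach and Riesz
  let ev : 𝓓(Bo, ℝ) →ₗ[ℝ] ℝ :=
    { toFun := fun φ ↦ ∫ x, G x * φ x ∂μ
      map_add' := fun φ ψ ↦ by
        have e : ((φ + ψ : 𝓓(Bo, ℝ)) : E → ℝ) = (φ : E → ℝ) + (ψ : E → ℝ) := rfl
        simp only [e, Pi.add_apply, mul_add]
        exact integral_add (hGφi φ) (hGφi ψ)
      map_smul' := fun r φ ↦ by
        have e : ((r • φ : 𝓓(Bo, ℝ)) : E → ℝ) = fun y ↦ r * φ y := rfl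
        simp only [e, RingHom.id_apply, smul_eq_mul, ← integral_const_mul]
        exact integral_congr_ae (Eventually.of_forall fun x ↦ by ring) }
  have hev : ∀ φ : 𝓓(Bo, ℝ), ev φ = ∫ x, G x * φ x ∂μ := fun φ ↦ rfl
  have hker : LinearMap.ker Tm ≤ LinearMap.ker ev := by
    intro φ hφ
    rw [LinearMap.mem_ker] at hφ ⊢
    have h := hbound M₀ hM₀' φ
    rw [hφ, norm_zero, mul_zero] at h
    exact abs_nonpos_iff.1 h
  let ℓ₀ : LinearMap.range Tm →ₗ[ℝ] ℝ :=
    ((LinearMap.ker Tm).liftQ ev hker).comp Tm.quotKerEquivRange.symm.toLinearMap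
  have hℓ₀ : ∀ φ : 𝓓(Bo, ℝ), ℓ₀ ⟨Tm φ, LinearMap.mem_range_self Tm φ⟩ = ∫ x, G x * φ x ∂μ := by
    intro φ
    change ((LinearMap.ker Tm).liftQ ev hker) (Tm.quotKerEquivRange.symm ⟨Tm φ, _⟩) = _
    rw [LinearMap.quotKerEquivRange_symm_apply_image Tm φ (LinearMap.mem_range_self Tm φ)]
    rfl
  have hℓ₀b : ∀ M : ℝ, (∀ x ∈ closedBall x₀ ε, |G x| ≤ M) →
      ∀ w : LinearMap.range Tm, ‖ℓ₀ w‖ ≤ C₀ * V * M * ‖w‖ := by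
    rintro M hM ⟨w, hw⟩
    obtain ⟨φ, rfl⟩ := LinearMap.mem_range.1 hw
    rw [hℓ₀ φ, Real.norm_eq_abs]
    exact hbound M hM φ
  let ℓ₁ : LinearMap.range Tm →L[ℝ] ℝ := ℓ₀.mkContinuous (C₀ * V * M₀) (hℓ₀b M₀ hM₀')
  have hℓ₁n : ∀ M : ℝ, (∀ x ∈ closedBall x₀ ε, |G x| ≤ M) → ‖ℓ₁‖ ≤ C₀ * V * M := by
    intro M hM
    have hMnn : 0 ≤ M := (abs_nonneg _).trans (hM x₀ (mem_closedBall_self hε.le))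
    exact ContinuousLinearMap.opNorm_le_bound _ (by positivity) (hℓ₀b M hM)
  obtain ⟨g, hg, hgn⟩ := exists_extension_norm_eq (LinearMap.range Tm) ℓ₁
  set u₂ : Lp ℝ 2 μ := (InnerProductSpace.toDual ℝ (Lp ℝ 2 μ)).symm g with hu₂
  have hu₂n : ‖u₂‖ = ‖ℓ₁‖ := by rw [hu₂, LinearIsometryEquiv.norm_map, hgn]
  have hu₂ : ∀ φ : 𝓓(Bo, ℝ), ∫ x, u₂ x * smoothDiffOp Xc S A φ x ∂μ = ∫ x, G x * φ x ∂μ := by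
    intro φ
    have h1 : ⟪u₂, Tm φ⟫_ℝ = ∫ x, G x * φ x ∂μ := by
      rw [hu₂, InnerProductSpace.toDual_symm_apply, hg ⟨Tm φ, LinearMap.mem_range_self Tm φ⟩]
      exact hℓ₀ φ
    rw [← h1, MeasureTheory.L2.inner_def]
    refine integral_congr_ae ?_
    filter_upwards [(hmem φ).coeFn_toLp] with x hx
    rw [hTm, hx]
    simp only [RCLike.inner_apply, conj_trivial]
    ring
  have hmemu : MemLp (u₂ : E → ℝ) 2 μ := Lp.memLp u₂
  have hu₂sq : ∫ x, (u₂ : E → ℝ) x ^ 2 ∂μ = ‖u₂‖ ^ 2 := by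
    rw [← real_inner_self_eq_norm_sq, MeasureTheory.L2.inner_def]
    refine integral_congr_ae (Eventually.of_forall fun x ↦ ?_)
    simp only [RCLike.inner_apply, conj_trivial]
    ring
  -- regularity: `u₂` is smooth on `B` (Folland's Cor. (6.34) for the presentation `Q`)
  have hloc : LocallyIntegrableOn (u₂ : E → ℝ) B μ :=
    (hmemu.locallyIntegrable one_le_two).locallyIntegrableOn _
  let uD : 𝓓'(Bo, ℝ) :=
    (TestFunction.integralAgainstBilinCLM (ContinuousLinearMap.mul ℝ ℝ) μ (u₂ : E → ℝ) :
      𝓓(Bo, ℝ) →L[ℝ] ℝ)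
  have huD : ∀ φ : 𝓓(Bo, ℝ), uD φ = ∫ x, φ x * u₂ x ∂μ := by
    intro φ
    change TestFunction.integralAgainstBilinCLM (ContinuousLinearMap.mul ℝ ℝ) μ (u₂ : E → ℝ) φ = _
    rw [TestFunction.integralAgainstBilinCLM_eq_integral hloc]
    simp
  have hellQ : IsEllipticOn Xc S A' 2 (Bo : Set E) :=
    isEllipticOn_divForm b c fun x _ ↦ divForm_pos_transpose (s := univ) (fun x _ ↦ hpos x) x
      (mem_univ x)
  have hhyp : IsHypoellipticOn Bo (smoothDiffOpTranspose Xc S A') μ :=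
    Folland1995_cor634_holds E μ κ Bo Xc S A' 2 hXs hA'S hellQ
  have himg : Distribution.ImageIsSmoothOn uD (smoothDiffOpTranspose Xc S A') μ B := by
    refine ⟨G, hG.contDiffOn, fun φ ψ _ hψ ↦ ?_⟩
    rw [huD ψ, ← hu₂ φ]
    refine integral_congr_ae (Eventually.of_forall fun x ↦ ?_)
    dsimp only
    rw [hψ, hQt φ.contDiff x, mul_comm]
  obtain ⟨w, hw, hwint⟩ := hhyp uD B hBo Subset.rfl himg
  -- `u₂ = w` a.e. on `B`
  have hwB : LocallyIntegrableOn w B μ := hw.continuousOn.locallyIntegrableOn hBm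
  have hz : ∀ᵐ x ∂μ, x ∈ B → (u₂ : E → ℝ) x = w x := by
    have h0 := hBo.ae_eq_zero_of_integral_contDiff_smul_eq_zero (μ := μ)
      (f := fun x ↦ (u₂ : E → ℝ) x - w x) (hloc.sub hwB) (fun g hg hgc hgU ↦ by
        let φg : 𝓓(Bo, ℝ) := ⟨g, hg, hgc, hgU⟩
        have h1 : ∫ x, g x * u₂ x ∂μ = ∫ x, w x * g x ∂μ := by
          have := hwint φg hgU
          rw [huD] at this
          exact this
        have hi1 : Integrable (fun x ↦ g x * u₂ x) μ :=
          TestFunction.integrable_bilin (ContinuousLinearMap.mul ℝ ℝ) hloc φg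
        have hi2 : Integrable (fun x ↦ g x * w x) μ :=
          TestFunction.integrable_bilin (ContinuousLinearMap.mul ℝ ℝ) hwB φg
        simp only [smul_eq_mul, mul_sub]
        rw [integral_sub hi1 hi2, h1, sub_eq_zero]
        exact integral_congr_ae (Eventually.of_forall fun x ↦ mul_comm _ _))
    filter_upwards [h0] with x hx hxB
    exact sub_eq_zero.1 (hx hxB)
  -- the weak equation for `w`: `∫ w Pφ = ∫ G φ`
  have hweak : ∀ φ : 𝓓(Bo, ℝ), ∫ x, w x * smoothDiffOp Xc S A φ x ∂μ = ∫ x, G x * φ x ∂μ := by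
    intro φ
    rw [← hu₂ φ]
    refine integral_congr_ae ?_
    filter_upwards [hz] with x hx
    by_cases hxB : x ∈ B
    · rw [hx hxB]
    · have hx' : x ∉ tsupport (smoothDiffOp Xc S A φ) := fun h ↦ hxB (hPsupp φ h)
      rw [image_eq_zero_of_notMem_tsupport hx', mul_zero, mul_zero]
  refine ⟨w, hw, ?_, ?_⟩
  · -- the classical equation on `B`
    set F : E → ℝ := fun y ↦ (∑ i, ∑ j, fderiv ℝ (fun z ↦ a i j z * fderiv ℝ w z (b i)) y (b j)) -
      c y * w y - G y with hF
    have hFc : ContinuousOn F B := (continuousOn_divFormOp b ha hc hBo hw).sub hG.continuous.continuousOn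
    -- `∫ F φ = 0` for test functions `φ` on `B`
    have hFint : ∀ φ : E → ℝ, ContDiff ℝ ∞ φ → HasCompactSupport φ → tsupport φ ⊆ B →
        ∫ x, φ x • F x ∂μ = 0 := by
      intro φ hφ hφc hφB
      -- an open `W`, `tsupport φ ⊆ W`, `closure W ⊆ B` compact, and a cutoff `χ = 1` on it
      obtain ⟨W, hWo, hφW, hWB, hWc⟩ :=
        exists_open_between_and_isCompact_closure hφc hBo hφB
      obtain ⟨χ, hχs, hχc, hχB, hχ1⟩ := exists_bump hWc hBo hWB
      set wt : E → ℝ := fun x ↦ χ x * w x with hwt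
      have hwts : ContDiff ℝ ∞ wt := contDiff_mul_of_tsupport_subset hBo hχs hχB hw
      have hwtc : HasCompactSupport wt := hχc.mul_right
      have hwtW : ∀ y ∈ W, wt =ᶠ[𝓝 y] w := by
        intro y hy
        filter_upwards [hWo.mem_nhds hy] with z hz
        rw [hwt]; dsimp only; rw [hχ1 z (subset_closure hz), one_mul]
      let φt : 𝓓(Bo, ℝ) := ⟨φ, hφ, hφc, hφB⟩
      -- `∫ G φ = ∫ w Pφ = ∫ wt Pφ = ∫ φ ᵗP(wt) = ∫ φ L(wt) = ∫ φ Lw`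
      have h1 : ∫ x, G x * φ x ∂μ = ∫ x, wt x * smoothDiffOp Xc S A φ x ∂μ := by
        have hw' := hweak φt
        change ∫ x, w x * smoothDiffOp Xc S A φ x ∂μ = ∫ x, G x * φ x ∂μ at hw'
        rw [← hw']
        refine integral_congr_ae (Eventually.of_forall fun x ↦ ?_)
        dsimp only
        by_cases hxW : x ∈ W
        · rw [(hwtW x hxW).self_of_nhds]
        · have hx' : x ∉ tsupport (smoothDiffOp Xc S A φ) := fun h ↦
            hxW (hφW (tsupport_smoothDiffOp_subset S A _ h))
          rw [image_eq_zero_of_notMem_tsupport hx', mul_zero, mul_zero]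
      have h2 : ∫ x, wt x * smoothDiffOp Xc S A φ x ∂μ =
          ∫ x, φ x * smoothDiffOpTranspose Xc S A wt x ∂μ := by
        have h := integral_smoothDiffOp_mul (μ := μ) hXs hAS hφ hwts hwtc
        rw [← h]
        exact integral_congr_ae (Eventually.of_forall fun x ↦ mul_comm _ _)
      have h3 : ∀ x, φ x * smoothDiffOpTranspose Xc S A wt x =
          φ x * ((∑ i, ∑ j, fderiv ℝ (fun z ↦ a i j z * fderiv ℝ w z (b i)) x (b j)) -
            c x * w x) := by
        intro x
        by_cases hxW : x ∈ W
        · rw [hPt hwts x, divFormOp_congr_of_eventuallyEq b a c (hwtW x hxW)]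
        · have hx' : x ∉ tsupport φ := fun h ↦ hxW (hφW h)
          rw [image_eq_zero_of_notMem_tsupport hx', zero_mul, zero_mul]
      have hGφ : Integrable (fun x ↦ G x * φ x) μ :=
        (hG.continuous.mul hφ.continuous).integrable_of_hasCompactSupport hφc.mul_left
      have hLφ : Integrable (fun x ↦ φ x * ((∑ i, ∑ j,
          fderiv ℝ (fun z ↦ a i j z * fderiv ℝ w z (b i)) x (b j)) - c x * w x)) μ := by
        have : (fun x ↦ φ x * ((∑ i, ∑ j,
            fderiv ℝ (fun z ↦ a i j z * fderiv ℝ w z (b i)) x (b j)) - c x * w x)) =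
            fun x ↦ φ x * smoothDiffOpTranspose Xc S A wt x := funext fun x ↦ (h3 x).symm
        rw [this]
        exact (hφ.continuous.mul (contDiff_smoothDiffOpTranspose hXs hAS hwts).continuous)
          |>.integrable_of_hasCompactSupport hφc.mul_right
      have h4 : ∫ x, G x * φ x ∂μ = ∫ x, φ x * ((∑ i, ∑ j,
          fderiv ℝ (fun z ↦ a i j z * fderiv ℝ w z (b i)) x (b j)) - c x * w x) ∂μ := by
        rw [h1, h2]
        exact integral_congr_ae (Eventually.of_forall h3)
      have h5 : (fun x ↦ φ x • F x) = fun x ↦ φ x * ((∑ i, ∑ j,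
          fderiv ℝ (fun z ↦ a i j z * fderiv ℝ w z (b i)) x (b j)) - c x * w x) - G x * φ x := by
        funext x; rw [hF]; simp only [smul_eq_mul]; ring
      rw [h5, integral_sub hLφ hGφ, ← h4, sub_self]
    have hae := hBo.ae_eq_zero_of_integral_contDiff_smul_eq_zero (μ := μ)
      (hFc.locallyIntegrableOn hBm) hFint
    -- continuity upgrades "a.e. on `B`" to "everywhere on `B`"
    intro x hx
    by_contra hne
    have hFx : F x ≠ 0 := fun h ↦ hne (sub_eq_zero.1 h)
    have hO : IsOpen (B ∩ F ⁻¹' {0}ᶜ) := hFc.isOpen_inter_preimage hBo isOpen_compl_singleton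
    have hpos' : 0 < μ (B ∩ F ⁻¹' {0}ᶜ) := hO.measure_pos μ ⟨x, hx, hFx⟩
    have hnull : μ (B ∩ F ⁻¹' {0}ᶜ) = 0 := by
      refine measure_mono_null (fun y hy ↦ ?_) (ae_iff.1 hae)
      exact fun h ↦ hy.2 (h hy.1)
    exact hpos'.ne' hnull
  · -- the `L²` bound
    intro M hM
    have h1 : ∫ x in B, w x ^ 2 ∂μ = ∫ x in B, (u₂ : E → ℝ) x ^ 2 ∂μ := by
      refine setIntegral_congr_ae hBm ?_
      filter_upwards [hz] with x hx hxB
      rw [hx hxB]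
    have h2 : ∫ x in B, (u₂ : E → ℝ) x ^ 2 ∂μ ≤ ∫ x, (u₂ : E → ℝ) x ^ 2 ∂μ :=
      setIntegral_le_integral hmemu.integrable_sq (Eventually.of_forall fun x ↦ sq_nonneg _)
    have h3 : ‖u₂‖ ≤ C₀ * V * M := hu₂n ▸ hℓ₁n M hM
    have hMnn : 0 ≤ M := (abs_nonneg _).trans (hM x₀ (mem_closedBall_self hε.le))
    calc ∫ x in B, w x ^ 2 ∂μ ≤ ‖u₂‖ ^ 2 := by rw [h1, ← hu₂sq]; exact h2
      _ ≤ (C₀ * V * M) ^ 2 := pow_le_pow_left₀ (norm_nonneg _) h3 2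
      _ = C₀ ^ 2 * V ^ 2 * M ^ 2 := by ring

end Solvability

end Literature.Analysis.Distribution
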